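import Mathlib
import Summits.Ventures.PercRepro2.RootCutRatio

/-!
# The root-shield identity: `btw(x) = FMfun(x) = 0` when a mark is separated from `x` and the
other mark by the root pair
(blind cell PercRepro2, night-1 g33; proofs/NIGHT1-G33.md; the paper proof is NIGHT1-G32.md §6; census
first: 281/281 targeted + 163/163 random (g32), the atom identities 868/868 and the identity with the
other mark a root 429/429 (g33, mining/night-1/g33/check_shield_atoms.py))

Let the roots `a₁, a₂` separate `VR` from `VS` (`RootCut.IsRootCut ends a₁ a₂ ↑VR ↑VS ER ES`) and let
`x ∈ VS` be the explored vertex.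
* **`o` shielded** (`o ∈ VR`, `b ∈ VS ∪ {a₁, a₂}`): the `o`-data of every fibre of `x` is, after
  summing over the `R`-part of the fibre, proportional to the fibre mass with the constants
  `κ_{a₁}(o) ± κ_{a₂}(o)` on all three root classes, so the centring `γ = D_o/D` equals
  `(κ₁ + κ₂)/ρ` (when `D ≠ 0`), `Φ_γ(T) = κ₁ − κ₂` is constant and both covariance-type terms
  cancel; the `A`-terms cancel likewise: **`btw_rootShield_o`** (`D ≠ 0`), **`FMfun_rootShield_o`**
  (no hypothesis; at `P(Q) = 0` every mass vanishes).
* **`b` shielded** (`b ∈ VR`, `o ∈ VS ∪ {a₁, a₂}`): the `b`-ratio `Sb/m_W` is the constant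
  `(κ_{a₁}(b) − κ_{a₂}(b))/ρ` on every fibre, so the covariance terms cancel for EVERY centring:
  **`btwg_rootShield_b`** (`D ≠ 0`, any `γ`), **`btw_rootShield_b`**, **`FMfun_rootShield_b`**.
* Consequences, all unconditional: (MEANS-a₃) at `x` (`A3Between_rootShield_o`,
  `A3Between_rootShield_b`; at `D = 0` by the cell's `RootEdge.A3Between_of_PD_null`), (HCOV) at `x`
  (`HCov_rootShield_o`, `HCov_rootShield_b`) and (FM) at `x` (`FM_rootShield_o`, `FM_rootShield_b`).
NOT claimed: the identity `btw = 0` at `D = 0` (true on the census, 28/28 + 24/24).  Standard axioms.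
-/

namespace Summit.Ventures.PercRepro2

open UnionCluster CovForm CutV

namespace CovForm

namespace A3Fibre

namespace RootShield

section Shield

variable {V : Type*} {E : Type*} [Fintype V] [DecidableEq V] [Fintype E] [DecidableEq E]
  {R : Type*} [Field R] [LinearOrder R] [IsStrictOrderedRing R] {ends : E → Sym2 V} {a₁ a₂ : V}
  {VR VS : Finset V} {ER ES : Set E} [DecidablePred (· ∈ ER)] [DecidablePred (· ∈ ES)] {p : E → R}

omit [Fintype V] [DecidableEq V] [DecidablePred (· ∈ ER)] [DecidablePred (· ∈ ES)] in
/-- `P(Q) ≠ 0` when `P(PD) ≠ 0`. -/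
lemma prob_Q_ne_zero_of_PD (hp : IsProbVec p) {x : V} (hD : prob p (PDEvent ends a₁ a₂ x) ≠ 0) :
    prob p (avoidAll ends a₂ {a₁}) ≠ 0 := by
  intro h0
  apply hD
  have key := prob_PD_le_Q hp ends a₁ a₂ x
  rw [h0] at key
  exact le_antisymm key (prob_nonneg hp _)

omit [DecidablePred (· ∈ ER)] [DecidablePred (· ∈ ES)] in
/-- At `P(Q) = 0` the first-order functional vanishes: every fibre mass is null. -/
lemma FMfun_eq_zero_of_Q_eq_zero (hp : IsProbVec p) (o x b : V)
    (hQ : prob p (avoidAll ends a₂ {a₁}) = 0) : FMfun p ends o a₁ a₂ x b = 0 := by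
  have hm : ∀ W, mW p ends a₁ a₂ x W = 0 := fun W => by
    have key := prob_mono hp (Set.inter_subset_left : fibre ends a₁ a₂ x W ⊆ avoidAll ends a₂ {a₁})
    rw [hQ] at key
    exact le_antisymm key (prob_nonneg hp _)
  have hs : ∀ y W, Ssig p ends a₁ a₂ x y W = 0 :=
    fun y W => Ssig_eq_zero_of_mW_eq_zero hp ends a₁ a₂ x y W (hm W)
  have hu : ∀ y W, Su p ends a₁ a₂ x y W = 0 :=
    fun y W => Su_eq_zero_of_mW_eq_zero hp ends a₁ a₂ x y W (hm W)
  unfold FMfun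
  simp [hs, hu, hm, hQ]

/-! ## The mark `o` shielded by the roots -/

/-- **The root-shield identity, `o` shielded**: `btw(x) = 0` for `o ∈ VR`, `x ∈ VS`,
`b ∈ VS ∪ {a₁, a₂}`, when `P(PD_x) ≠ 0`. -/
theorem btw_rootShield_o (hp : IsProbVec p) (h : RootCut.IsRootCut ends a₁ a₂ ↑VR ↑VS ER ES)
    {x : V} (hx : x ∈ VS) {b : V} (hb : b ∈ (↑VS : Set V) ∪ {a₁, a₂}) {o : V}
    (ho : o ∈ (↑VR : Set V) ∪ {a₁, a₂}) (hD : prob p (PDEvent ends a₁ a₂ x) ≠ 0) :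
    btw p ends o a₁ a₂ x b = 0 := by
  have hQ := prob_Q_ne_zero_of_PD hp hD
  have hγ : gamma p ends o a₁ a₂ x * rhoR p ends a₁ a₂ ER -
      (kap p ends a₁ a₂ ER a₁ o + kap p ends a₁ a₂ ER a₂ o) = 0 := by
    unfold gamma
    rw [Do_eq_fibresA, sum_SuA_R h hx ho, prob_PD_rs h hx]
    rw [prob_PD_rs h hx] at hD
    have hρ := left_ne_zero_of_mul hD
    have hd := right_ne_zero_of_mul hD
    field_simp
    ring
  rw [← RootEdge.btwg_gamma]
  unfold RootEdge.btwg
  rw [sum_term_oR hp h hx hb ho, sum_Ssig_S h hx hb, sum_SFg_oR h hx ho, sum_termA_oR hp h hx hb ho,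
    sum_SuA_S h hx hb, sum_SuA_R h hx ho, prob_Q_rs h hx, prob_PD_rs h hx]
  rw [prob_Q_rs h hx] at hQ
  rw [prob_PD_rs h hx] at hD
  have hρ := left_ne_zero_of_mul hD
  have hd := right_ne_zero_of_mul hD
  have hσ := right_ne_zero_of_mul hQ
  simp only [hγ, mul_zero, add_zero, ← Finset.sum_mul]
  field_simp
  ring

/-- **The root-shield identity for (FM), `o` shielded**: `FMfun(x) = 0` for `o ∈ VR`, `x ∈ VS`,
`b ∈ VS ∪ {a₁, a₂}`. -/
theorem FMfun_rootShield_o (hp : IsProbVec p) (h : RootCut.IsRootCut ends a₁ a₂ ↑VR ↑VS ER ES)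
    {x : V} (hx : x ∈ VS) {b : V} (hb : b ∈ (↑VS : Set V) ∪ {a₁, a₂}) {o : V}
    (ho : o ∈ (↑VR : Set V) ∪ {a₁, a₂}) : FMfun p ends o a₁ a₂ x b = 0 := by
  by_cases hQ : prob p (avoidAll ends a₂ {a₁}) = 0
  · exact FMfun_eq_zero_of_Q_eq_zero hp o x b hQ
  have hγ : gamma0 p ends o a₁ a₂ * rhoR p ends a₁ a₂ ER -
      (kap p ends a₁ a₂ ER a₁ o + kap p ends a₁ a₂ ER a₂ o) = 0 := by
    unfold gamma0
    rw [mU_R h hx ho, prob_Q_rs h hx]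
    rw [prob_Q_rs h hx] at hQ
    have hρ := left_ne_zero_of_mul hQ
    have hσ := right_ne_zero_of_mul hQ
    field_simp
    ring
  unfold FMfun
  rw [sum_term_oR hp h hx hb ho, sum_Ssig_S h hx hb, sum_SFg_oR h hx ho, sum_termA_oR hp h hx hb ho,
    sum_SuA_S h hx hb, sum_SuA_R h hx ho, mU_R h hx ho, mU_S h hx hb, prob_Q_rs h hx,
    prob_PD_rs h hx]
  rw [prob_Q_rs h hx] at hQ
  have hρ := left_ne_zero_of_mul hQ
  have hσ := right_ne_zero_of_mul hQ
  simp only [hγ, mul_zero, add_zero, ← Finset.sum_mul]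
  field_simp
  ring

/-- **(MEANS-a₃) at `x` with `o` shielded**, unconditionally (at `P(PD_x) = 0` by
`RootEdge.A3Between_of_PD_null`, the a.s.-constancy of `σ_x` on `Q`). -/
theorem A3Between_rootShield_o (hp : IsProbVec p) (h : RootCut.IsRootCut ends a₁ a₂ ↑VR ↑VS ER ES)
    {x : V} (hx : x ∈ VS) {b : V} (hb : b ∈ (↑VS : Set V) ∪ {a₁, a₂}) {o : V}
    (ho : o ∈ (↑VR : Set V) ∪ {a₁, a₂}) : A3Between p ends o a₁ a₂ x b := by
  by_cases hD : prob p (PDEvent ends a₁ a₂ x) = 0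
  · exact RootEdge.A3Between_of_PD_null p hp o b hD
  · unfold A3Between
    rw [btw_rootShield_o hp h hx hb ho hD]

/-- (FM) at `x` with `o` shielded. -/
theorem FM_rootShield_o (hp : IsProbVec p) (h : RootCut.IsRootCut ends a₁ a₂ ↑VR ↑VS ER ES)
    {x : V} (hx : x ∈ VS) {b : V} (hb : b ∈ (↑VS : Set V) ∪ {a₁, a₂}) {o : V}
    (ho : o ∈ (↑VR : Set V) ∪ {a₁, a₂}) : FM p ends o a₁ a₂ x b := by
  unfold FM
  rw [FMfun_rootShield_o hp h hx hb ho]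

/-- **(HCOV) at `x` with `o` shielded**. -/
theorem HCov_rootShield_o (hp : IsProbVec p) (h : RootCut.IsRootCut ends a₁ a₂ ↑VR ↑VS ER ES)
    {x : V} (hx : x ∈ VS) {b : V} (hb : b ∈ (↑VS : Set V) ∪ {a₁, a₂}) {o : V}
    (ho : o ∈ (↑VR : Set V) ∪ {a₁, a₂}) : HCov p ends o a₁ a₂ x b :=
  HCov_of_a3Between hp ends o a₁ a₂ x b (A3Between_rootShield_o hp h hx hb ho)

/-! ## The mark `b` shielded by the roots -/

/-- **The root-shield identity, `b` shielded, at EVERY centring**: `btwg(x, γ) = 0` for `b ∈ VR`,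
`x ∈ VS`, `o ∈ VS ∪ {a₁, a₂}`, when `P(PD_x) ≠ 0`. -/
theorem btwg_rootShield_b (hp : IsProbVec p) (h : RootCut.IsRootCut ends a₁ a₂ ↑VR ↑VS ER ES)
    {x : V} (hx : x ∈ VS) {b : V} (hb : b ∈ (↑VR : Set V) ∪ {a₁, a₂}) {o : V}
    (ho : o ∈ (↑VS : Set V) ∪ {a₁, a₂}) (hD : prob p (PDEvent ends a₁ a₂ x) ≠ 0) (γ : R) :
    RootEdge.btwg p ends o a₁ a₂ x b γ = 0 := by
  have hQ := prob_Q_ne_zero_of_PD hp hD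
  unfold RootEdge.btwg
  rw [sum_term_bR hp h hx hb ho, sum_Ssig_R h hx hb, sum_SFg_oS h hx ho, sum_termA_bR hp h hx hb ho,
    sum_SuA_R h hx hb, sum_SuA_S h hx ho, prob_Q_rs h hx, prob_PD_rs h hx]
  rw [prob_Q_rs h hx] at hQ
  rw [prob_PD_rs h hx] at hD
  have hρ := left_ne_zero_of_mul hD
  have hd := right_ne_zero_of_mul hD
  have hσ := right_ne_zero_of_mul hQ
  field_simp
  ring

/-- **The root-shield identity, `b` shielded**: `btw(x) = 0` (`P(PD_x) ≠ 0`). -/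
theorem btw_rootShield_b (hp : IsProbVec p) (h : RootCut.IsRootCut ends a₁ a₂ ↑VR ↑VS ER ES)
    {x : V} (hx : x ∈ VS) {b : V} (hb : b ∈ (↑VR : Set V) ∪ {a₁, a₂}) {o : V}
    (ho : o ∈ (↑VS : Set V) ∪ {a₁, a₂}) (hD : prob p (PDEvent ends a₁ a₂ x) ≠ 0) :
    btw p ends o a₁ a₂ x b = 0 := by
  rw [← RootEdge.btwg_gamma]
  exact btwg_rootShield_b hp h hx hb ho hD _

/-- **The root-shield identity for (FM), `b` shielded**: `FMfun(x) = 0`. -/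
theorem FMfun_rootShield_b (hp : IsProbVec p) (h : RootCut.IsRootCut ends a₁ a₂ ↑VR ↑VS ER ES)
    {x : V} (hx : x ∈ VS) {b : V} (hb : b ∈ (↑VR : Set V) ∪ {a₁, a₂}) {o : V}
    (ho : o ∈ (↑VS : Set V) ∪ {a₁, a₂}) : FMfun p ends o a₁ a₂ x b = 0 := by
  by_cases hQ : prob p (avoidAll ends a₂ {a₁}) = 0
  · exact FMfun_eq_zero_of_Q_eq_zero hp o x b hQ
  unfold FMfun
  rw [sum_term_bR hp h hx hb ho, sum_Ssig_R h hx hb, sum_SFg_oS h hx ho, sum_termA_bR hp h hx hb ho,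
    sum_SuA_R h hx hb, sum_SuA_S h hx ho, mU_R h hx hb, mU_S h hx ho, prob_Q_rs h hx,
    prob_PD_rs h hx]
  rw [prob_Q_rs h hx] at hQ
  have hρ := left_ne_zero_of_mul hQ
  have hσ := right_ne_zero_of_mul hQ
  field_simp
  ring

/-- **(MEANS-a₃) at `x` with `b` shielded**, unconditionally. -/
theorem A3Between_rootShield_b (hp : IsProbVec p) (h : RootCut.IsRootCut ends a₁ a₂ ↑VR ↑VS ER ES)
    {x : V} (hx : x ∈ VS) {b : V} (hb : b ∈ (↑VR : Set V) ∪ {a₁, a₂}) {o : V}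
    (ho : o ∈ (↑VS : Set V) ∪ {a₁, a₂}) : A3Between p ends o a₁ a₂ x b := by
  by_cases hD : prob p (PDEvent ends a₁ a₂ x) = 0
  · exact RootEdge.A3Between_of_PD_null p hp o b hD
  · unfold A3Between
    rw [btw_rootShield_b hp h hx hb ho hD]

/-- (FM) at `x` with `b` shielded. -/
theorem FM_rootShield_b (hp : IsProbVec p) (h : RootCut.IsRootCut ends a₁ a₂ ↑VR ↑VS ER ES)
    {x : V} (hx : x ∈ VS) {b : V} (hb : b ∈ (↑VR : Set V) ∪ {a₁, a₂}) {o : V}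
    (ho : o ∈ (↑VS : Set V) ∪ {a₁, a₂}) : FM p ends o a₁ a₂ x b := by
  unfold FM
  rw [FMfun_rootShield_b hp h hx hb ho]

/-- **(HCOV) at `x` with `b` shielded**. -/
theorem HCov_rootShield_b (hp : IsProbVec p) (h : RootCut.IsRootCut ends a₁ a₂ ↑VR ↑VS ER ES)
    {x : V} (hx : x ∈ VS) {b : V} (hb : b ∈ (↑VR : Set V) ∪ {a₁, a₂}) {o : V}
    (ho : o ∈ (↑VS : Set V) ∪ {a₁, a₂}) : HCov p ends o a₁ a₂ x b :=
  HCov_of_a3Between hp ends o a₁ a₂ x b (A3Between_rootShield_b hp h hx hb ho)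

end Shield

end RootShield

end A3Fibre

end CovForm

end Summit.Ventures.PercRepro2
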